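import Summits.HubbardSuperconductivity.HubbardSuperconductivity.Theorems.LevyLogBootstrapDressHalfFilledInterHopping
import Literature.MathematicalPhysics.QuantumLattice.ClusterProductHops
import Literature.MathematicalPhysics.QuantumLattice.TorusPlaquetteDictionaryMap
import HarnessLib

/-!
# Route `LevyLogBootstrap` / `AnisotropyChord`, crux `DressHalfFilled` (stmt-HubbardSuperconductivity-8148), stub 2
# `stub_plaquetteDictionary`, clause (d) — step 1 of the inter-plaquette locality: ONE application of the
# inter-plaquette hopping to a dictionary column is a sum of two-cluster slices of hop vectors

Support file (`--supports stmt-HubbardSuperconductivity-8148`), step 1 of the plan for the unlanded `InterLocality`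
(matrix elements of Kato's kernel `T S(E₀) T` between dictionary columns, bond by bond):

`T col_σ = -Σ_{R,k} slice_{R, R+e_k}(ψ_σ) · hopVec_{R,k}(σ)` where `T = hamiltonian G_inter 1 0`
(`hamiltonian_inter_eq_bondSum`), `col_σ = Π_R ψ_σ(R)` the Koszul product of plaquette ground states
(`TorusPlaquette.plaqFamily`), `slice` the two-cluster slice map of `ClusterProductSlice` and the hop vector the
two-cluster tensor of `InterClusterKernelHopVectors` with the Koszul orientation signs
(`ClusterProductHops.creation_emb_mul_annihilation_emb_mulVec_prodFamily_eq_sliceMap(')`):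
`hop_mulVec_col` / `hop'_mulVec_col` (one oriented hop = signed slice of a tensor), `hamiltonian_inter_mulVec_col` (the sum).
Next steps (not in this file): cross terms between different bonds vanish (`ClusterProductSliceCross`), diagonal terms
reduce to `-interClusterKernel` (`ClusterProductSlice.star_sliceMap_mulVec_dotProduct_reducedResolvent_sliceMap_mulVec` +
`InterClusterKernelHopVectors.star_hopVec_dotProduct_reducedResolvent_hopVec_eq_neg_interClusterKernel`).

References: W.-F. Tsai, S. A. Kivelson, PRB 73 (2006) 214510, App. A (A1) [TsaiKivelson2006]. [folklore]
-/

set_option linter.dupNamespace false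

noncomputable section

namespace Summit.HubbardSuperconductivity.HubbardSuperconductivity.Theorems.LevyLogBootstrap

open Matrix Literature.MathematicalPhysics.QuantumLattice Literature.Probability.LatticeModels
open Literature.MathematicalPhysics.QuantumLattice.TorusPlaquette TwoCluster

variable {M : ℕ}

/-- The plaquette factors of a dictionary column are even. [folklore] -/
theorem hasParity_plaqFamily (U : ℝ) (σ : TensorIndex (TorusSite 2 M) 2) (R : FermionTorus 2 M) :
    HasParity 0 (plaqFamily U σ R) :=
  hasParity_plaquetteStates U _

variable [NeZero M]

/-- One inter-plaquette hop on a dictionary column, as a two-cluster slice (orientation `R → R + e_k`). [folklore] -/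
theorem hop_mulVec_col (hM : 2 ≤ M) (U : ℝ) (σ : TensorIndex (TorusSite 2 M) 2) (R : FermionTorus 2 M)
    (k : Fin 2) (q : PlaquetteSite × PlaquetteSite) (s : Fin 2) :
    (creation (orb (plaqSite M R q.1) s) * annihilation (orb (plaqSite M (plaqNbr R k) q.2) s)) *ᵥ
        (plaquettePartition M).prodFamily (plaqFamily U σ) =
      (if plaqNbr R k < R then (-1 : ℂ) else 1) •
        ((plaquettePartition M).sliceMap (plaqFamily U σ) R (plaqNbr R k) *ᵥ
          tensorVec (creation (orb q.1 s) *ᵥ plaqFamily U σ R)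
            (annihilation (orb q.2 s) *ᵥ plaqFamily U σ (plaqNbr R k))) := by
  have h := (plaquettePartition M).creation_emb_mul_annihilation_emb_mulVec_prodFamily_eq_sliceMap
    (hasParity_plaqFamily U σ) (plaqNbr_ne hM R k).symm (orb q.1 s) (orb q.2 s)
  simpa only [plaquettePartition_emb, plaqOrbEmb_orb] using h

/-- The reverse hop (orientation `R + e_k → R`). [folklore] -/
theorem hop'_mulVec_col (hM : 2 ≤ M) (U : ℝ) (σ : TensorIndex (TorusSite 2 M) 2) (R : FermionTorus 2 M)
    (k : Fin 2) (q : PlaquetteSite × PlaquetteSite) (s : Fin 2) :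
    (creation (orb (plaqSite M (plaqNbr R k) q.2) s) * annihilation (orb (plaqSite M R q.1) s)) *ᵥ
        (plaquettePartition M).prodFamily (plaqFamily U σ) =
      (if R < plaqNbr R k then (-1 : ℂ) else 1) •
        ((plaquettePartition M).sliceMap (plaqFamily U σ) R (plaqNbr R k) *ᵥ
          tensorVec (annihilation (orb q.1 s) *ᵥ plaqFamily U σ R)
            (creation (orb q.2 s) *ᵥ plaqFamily U σ (plaqNbr R k))) := by
  have h := (plaquettePartition M).creation_emb_mul_annihilation_emb_mulVec_prodFamily_eq_sliceMap'
    (hasParity_plaqFamily U σ) (plaqNbr_ne hM R k).symm (orb q.1 s) (orb q.2 s)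
  simpa only [plaquettePartition_emb, plaqOrbEmb_orb] using h

/-- **`T col_σ` as a sum of two-cluster slices of hop vectors** (`M ≥ 2`). [cite: TsaiKivelson2006, App. A (A1)] -/
theorem hamiltonian_inter_mulVec_col (hM : 2 ≤ M) (U : ℝ) (σ : TensorIndex (TorusSite 2 M) 2) :
    hamiltonian (fermionTorusGraph 2 (2 * M) ⊓ SimpleGraph.comap
        (fun x : FermionTorus 2 (2 * M) => fun i : Fin 2 => ((ofLex x) i : ℕ) / 2) ⊤) 1 0 *ᵥ
        (plaquettePartition M).prodFamily (plaqFamily U σ) =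
      -∑ R : FermionTorus 2 M, ∑ k : Fin 2,
        (plaquettePartition M).sliceMap (plaqFamily U σ) R (plaqNbr R k) *ᵥ
          ∑ q ∈ (![plaquetteBonds, plaquetteBondsV] : Fin 2 → Finset (PlaquetteSite × PlaquetteSite)) k,
            ∑ s : Fin 2,
              ((if plaqNbr R k < R then (-1 : ℂ) else 1) •
                  tensorVec (creation (orb q.1 s) *ᵥ plaqFamily U σ R)
                    (annihilation (orb q.2 s) *ᵥ plaqFamily U σ (plaqNbr R k)) +
                (if R < plaqNbr R k then (-1 : ℂ) else 1) •
                  tensorVec (annihilation (orb q.1 s) *ᵥ plaqFamily U σ R)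
                    (creation (orb q.2 s) *ᵥ plaqFamily U σ (plaqNbr R k))) := by
  rw [hamiltonian_inter_eq_bondSum hM, Matrix.neg_mulVec, Matrix.sum_mulVec]
  refine congrArg Neg.neg (Finset.sum_congr rfl fun R _ => ?_)
  rw [Matrix.sum_mulVec]
  refine Finset.sum_congr rfl fun k _ => ?_
  rw [Matrix.sum_mulVec, Matrix.mulVec_sum]
  refine Finset.sum_congr rfl fun q _ => ?_
  rw [Matrix.sum_mulVec, Matrix.mulVec_sum]
  refine Finset.sum_congr rfl fun s _ => ?_
  rw [Matrix.add_mulVec, Matrix.mulVec_add, Matrix.mulVec_smul, Matrix.mulVec_smul, hop_mulVec_col hM, hop'_mulVec_col hM]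

end Summit.HubbardSuperconductivity.HubbardSuperconductivity.Theorems.LevyLogBootstrap

end
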